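import Summits.QuantumFields.YangMills.Theorems.LuscherReductionDressedRitzPlateauDefs
import Summits.QuantumFields.YangMills.Theorems.FemtoTransferGapSlabFlowLift
import HarnessLib

/-!
# Route `LuscherReduction`, item `DressedRitz` (stmt-QuantumFields-20205), line «polyakovlift» (owner ym-beyond-p1 g21, registered 2026-08-27T09:59Z)
# — the line's OBJECTS and CLAUSE GROUPS as tree definitions (VERBATIM §0–§1 of the birth skeleton), plus the (o5)∧(o6) core of the dynamics group

Support DEFINITIONS of the `FemtoTransferGap` group (fleet service by seat ym-infvol-p2 g6; route `LuscherReduction`, femto rung R2b1; bears on the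
crux child `DressedRitz` = stmt-QuantumFields-20205).  SOURCE: the registered birth skeleton `pub/ym-beyond/p1-g21-files/Lines-polyakovlift.lean`
(sha16 9b069c059f21b79f, namespace `Summit.QuantumFields.YangMills.Cruxes.DressedRitz.PolyakovLift`; not importable) §0–§1, texts BYTE-IDENTICAL,
re-homed under `Summit.QuantumFields.YangMills.Theorems.FemtoTransferGap.PolyakovLift` so that (i) the owner can re-point the three registered stubs
`stub_liftStatics ∕ stub_liftDynamics ∕ stub_liftLeakage` at TREE constants (same device as `…ExplicitNoIntruderDefs`, p500991, and
`…TraceFormulaDefs`), (ii) stub provers state and land them over tree constants, and (iii) the companion `…PolyakovLiftGlue.lean` proves the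
compositions — including the one with the dynamics group WEAKENED to its (o5)∧(o6) core (`DynamicCoreClauses`, NEW here): the order clause (o1)
and the spread clause (o7) of `DynamicClauses` are redundant (`…PlateauSortFree.lean`, `…PlateauSpreadFree.lean`).

THE LINE (owner's design, card `Lines-polyakovlift.md` f9678e382ad4e66a): closing item 20205 = proving `∀ k, OpPlat.OperatorPlateauAt k`; the line
NAMES the insertions — `O_i := flowLiftAt 0 (L²/√λ) g_i`, the one-site eigen-ratio `g_i = e_{i+1}/e_0` at the Polyakov-scale coupling `B₁ = 2/λ³`
read on the Wilson-flowed Polyakov holonomy triple — and cuts the RG content by Euclidean time separation: STATICS (time 0: (o0), (o2)),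
DYNAMICS (time 1: (o1), (o5), (o6), (o7); load-bearing, XL), LEAKAGE (time 2: (o4)).

* `flowTime β L = L²/√λ`, `liftCoupling β L = 2/λ³`, `IsRawVacuum β φ`, `LiftBasis B k ω g`, `liftVec`, `liftFamily` (§0 verbatim);
* `StaticClauses`, `DynamicClauses`, `LeakageClause` (§1 verbatim = the conjuncts of `OpPlat.PlateauClauses` grouped by time separation);
* NEW `DynamicCoreClauses k C β u` := (o5) ∧ (o6) — what DYNAMICS must really deliver (glue: `…PolyakovLiftGlue.lean`).

HONEST FRAMING: definitions only, for a typed cut of the EXISTENCE half of Lüscher's femto-universe spectrum claim on the CONDITIONAL rung R2b1; the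
three stubs are OPEN renormalisation-group estimates; nothing here bears on infinite volume, the continuum limit or the Clay mass gap.
References: M. Lüscher, NPB 219 (1983) 233 [cite: Luscher1983, §3]; M. Lüscher, JHEP 08 (2010) 071 [cite: Luscher2010, §2];
Lüscher–Wolff, NPB 339 (1990) 222 [cite: LuscherWolff1990]; Reed–Simon IV [cite: ReedSimonIV1978, Thm XIII.43].
-/

set_option autoImplicit false

noncomputable section

open MeasureTheory Filter Topology Real
open Literature.MathematicalPhysics.QuantumFieldTheory (GaugeConfig Site gaugeTransform)
open scoped BigOperators

namespace Summit.QuantumFields.YangMills.Theorems.FemtoTransferGap.PolyakovLift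

open Summit.QuantumFields.YangMills.Theorems.FemtoTransferGap

/-! ## §0 The explicit objects of the line (definitions; no existential content) — VERBATIM from the birth skeleton -/

/-- Flow time of the lift: `t(β,L) = L²/√λ(β,L)` — flow radius `≫` box, growing as `λ → 0`.  WHY NOT `t = L²`: the residual stiff
(non-zero-momentum, incl. base-point dependence) admixture of a flowed Polyakov observable has spectral weight `≍ e^{-8π²t/L²}·λ` at lever
`2π/L`, and clauses (o4)/(o5) need that weight `o(λ³)`; a FIXED multiple of `L²` leaves `e^{-8π²}·λ` (asymptotically inadmissible, however
tiny), `L²/√λ` gives `λe^{-8π²/√λ}`.  WHY NOT MORE: the flow contracts the non-abelian zero mode at relative rate `≍ λ²/L²` (`ċ = −O(c³)`,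
`c ≍ λ/L`), so flow time `t` distorts the lifted argument by a relative `O(λ²t/L²)` = `O(λ^{3/2})` here — inside every tolerance ((o2): `O(λ)`;
(o4)–(o7): leakage weights `O(λ²)`) — while `t ≳ L²/λ` would saturate (o2) and `t ≳ L²/λ²` would break it.  Admissible window:
`L²·log(1/λ) ≲ t ≲ L²/λ`; the geometric middle is taken. [cite: Luscher2010, §2] [cite: Luscher1983, §3] -/
def flowTime (β : ℝ) (L : ℕ) : ℝ := (L : ℝ) ^ 2 / Real.sqrt (luscherLambda β L)

/-- The one-site coupling at the POLYAKOV scale, `B₁(β,L) = 2/λ(β,L)³` (`= oneSiteCoupling β L / L³`): the one-site wave functions at `B₁`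
live at scale `λ` in the link variable, the scale of the fine zero mode in the Polyakov variable. [cite: Luscher1983, §3] -/
def liftCoupling (β : ℝ) (L : ℕ) : ℝ := 2 / luscherLambda β L ^ 3

/-- `IsRawVacuum β φ`: `φ` is a physical, `l2`-normalised, exact top eigenfunction of the fine transfer operator (`K_βφ = λ₀φ`) — exactly the
three raw fields `IsVacuum.raw` of the vacuum dictionary (`Cruxes/RunningReduction/Lines/VacuumDictionary.lean` §1, seat ym-cruxidea-19978-1; to
land as `Theorems/…VacuumDictionary.lean`); by Jentzsch's theorem (tree `PhysL2.exists_groundState`, `levelValue_one_lt_levelValue_zero`) `φ = ±Ω`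
up to a null function, and every clause below is quadratic in `φ` and an integral, so the stubs quantify over it UNIVERSALLY at no cost. [cite: ReedSimonIV1978, Thm XIII.43] -/
def IsRawVacuum {L : ℕ} [NeZero L] (β : ℝ) (φ : GaugeConfig 3 L SU2 → ℝ) : Prop :=
  IsPhys φ ∧ l2 φ φ = 1 ∧ transferApply β φ = levelValue su2Rep L β 0 • φ

/-- `LiftBasis B k ω g` — a ONE-SITE EIGEN-RATIO BASIS at one-site coupling `B`: `ω` the physical, uniformly positive, normalised one-site
ground state (`K_Bω = μ₀(B)ω`), and `g_0 … g_{k−1}` physical one-site functions with `g_i·ω` `l2`-orthonormal EXACT excited eigenfunctions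
realising the multiset of the first `k` excited level values `μ₁(B) … μ_k(B)` IN SOME ORDER (`σ` a permutation: `K_B(g_iω) = μ_{σ(i)+1}(B)·g_iω`
— the labelling is the prover's, so that an accidental exact degeneracy between one-site multiplets never pins the fine order (o1) to a
wrong labelling; generically `σ = id`).  Exists for every `B > 0`, `k` (`exists_liftBasis`); free only up to the labelling and rotations
inside degenerate multiplets. [cite: ReedSimonIV1978, Thm XIII.1] -/
def LiftBasis (B : ℝ) (k : ℕ) (ω : GaugeConfig 3 1 SU2 → ℝ) (g : Fin k → (GaugeConfig 3 1 SU2 → ℝ)) : Prop :=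
  IsPhys ω ∧ (∃ c : ℝ, 0 < c ∧ ∀ V, c ≤ ω V) ∧ l2 ω ω = 1 ∧
  transferApply B ω = levelValue su2Rep 1 B 0 • ω ∧
  (∀ i, IsPhys (g i)) ∧
  (∃ σ : Equiv.Perm (Fin k), ∀ i : Fin k, transferApply B (g i * ω) = levelValue su2Rep 1 B ((σ i : ℕ) + 1) • (g i * ω)) ∧
  (∀ i l : Fin k, l2 (g i * ω) (g l * ω) = if i = l then 1 else 0)

/-- The LIFTED CHANNEL VECTOR `u = (g∘Π_t − ⟨g∘Π_t⟩_φ)·φ`: the one-site function `g` read on the flowed Polyakov holonomy triple at base point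
`0`, flow time `t(β,L) = L²/√λ`, vacuum-subtracted and applied to the vacuum `φ` (`OpPlat.ins`). [cite: LuscherWolff1990] [cite: Luscher2010, §2] -/
abbrev liftVec {L : ℕ} [NeZero L] (β : ℝ) (φ : GaugeConfig 3 L SU2 → ℝ) (g : GaugeConfig 3 1 SU2 → ℝ) : GaugeConfig 3 L SU2 → ℝ :=
  OpPlat.ins φ (flowLiftAt (L := L) 0 (flowTime β L) g)

/-- The lifted family `u_i = liftVec β φ g_i`. [cite: LuscherWolff1990] -/
abbrev liftFamily {L : ℕ} [NeZero L] {k : ℕ} (β : ℝ) (φ : GaugeConfig 3 L SU2 → ℝ) (g : Fin k → (GaugeConfig 3 1 SU2 → ℝ)) :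
    Fin k → (GaugeConfig 3 L SU2 → ℝ) :=
  fun i => liftVec β φ (g i)

/-! ## §1 The clause groups (VERBATIM conjuncts of `OpPlat.PlateauClauses`, grouped by Euclidean time separation) -/

/-- TIME-0 clauses (o0) `n_i > 0` and (o2) `|⟨u_i,u_l⟩| ≤ Cλ√n_i√n_l` (`i ≠ l`). [cite: LuscherWolff1990] -/
def StaticClauses (k : ℕ) (C : ℝ) {L : ℕ} [NeZero L] (β : ℝ) (u : Fin k → (GaugeConfig 3 L SU2 → ℝ)) : Prop :=
  (∀ i : Fin k, 0 < l2 (u i) (u i)) ∧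
  (∀ i l : Fin k, i ≠ l →
    |l2 (u i) (u l)| ≤ C * luscherLambda β L * (Real.sqrt (l2 (u i) (u i)) * Real.sqrt (l2 (u l) (u l))))

/-- TIME-1 clauses (o1) order, (o5) Lüscher position, (o6) symmetrised couplings, (o7) spread. [cite: Luscher1983, §3] [cite: LuscherWolff1990] -/
def DynamicClauses (k : ℕ) (C : ℝ) {L : ℕ} [NeZero L] (β : ℝ) (u : Fin k → (GaugeConfig 3 L SU2 → ℝ)) : Prop :=
  (∀ i l : Fin k, i ≤ l →
    l2 (u l) (transferApply β (u l)) * l2 (u i) (u i) ≤ l2 (u i) (transferApply β (u i)) * l2 (u l) (u l)) ∧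
  (∀ i : Fin k,
    l2 (u i) (transferApply β (u i)) * levelValue su2Rep 1 (oneSiteCoupling β L) 0 ≤
        Real.exp (C * luscherLambda β L ^ 2 / L) *
          (levelValue su2Rep 1 (oneSiteCoupling β L) ((i : ℕ) + 1) * levelValue su2Rep L β 0) * l2 (u i) (u i) ∧
    levelValue su2Rep 1 (oneSiteCoupling β L) ((i : ℕ) + 1) * levelValue su2Rep L β 0 * l2 (u i) (u i) ≤
        Real.exp (C * luscherLambda β L ^ 2 / L) *
          (l2 (u i) (transferApply β (u i)) * levelValue su2Rep 1 (oneSiteCoupling β L) 0)) ∧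
  (∀ i l : Fin k, i ≠ l →
    |l2 (u i) (transferApply β (u l)) -
        (l2 (u i) (transferApply β (u i)) / l2 (u i) (u i) + l2 (u l) (transferApply β (u l)) / l2 (u l) (u l)) / 2 *
          l2 (u i) (u l)|
      ≤ C * (luscherLambda β L ^ 2 / L) * levelValue su2Rep L β 0 *
          (Real.sqrt (l2 (u i) (u i)) * Real.sqrt (l2 (u l) (u l)))) ∧
  (∀ i : Fin k, levelValue su2Rep L β 0 * l2 (u i) (u i) - l2 (u i) (transferApply β (u i))
      ≤ C * (luscherLambda β L / L) * levelValue su2Rep L β 0 * l2 (u i) (u i))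

/-- TIME-2 clause (o4): single-state dominance `‖K_βu_i‖²·n_i − d_ii² ≤ C(λ³/L²)λ₀²·n_i²`. [cite: LuscherWolff1990] -/
def LeakageClause (k : ℕ) (C : ℝ) {L : ℕ} [NeZero L] (β : ℝ) (u : Fin k → (GaugeConfig 3 L SU2 → ℝ)) : Prop :=
  ∀ i : Fin k,
    l2 (transferApply β (u i)) (transferApply β (u i)) * l2 (u i) (u i) - l2 (u i) (transferApply β (u i)) ^ 2
      ≤ C * (luscherLambda β L ^ 3 / (L : ℝ) ^ 2) * levelValue su2Rep L β 0 ^ 2 * l2 (u i) (u i) ^ 2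

/-- ★ NEW — **the CORE of the time-1 group: (o5) Lüscher position ∧ (o6) symmetrised couplings.**  The other two conjuncts of `DynamicClauses` are
redundant: the ORDER clause (o1) by relabelling the one-site eigen-ratio basis (`KTGen.operatorCore_of_unsorted`, `…PlateauSortFree.lean`; a
relabelled `LiftBasis` is a `LiftBasis`), the SPREAD clause (o7) by (o5) + the closed crux ONE (`KTGen.plateauClauses_of_core`,
`…PlateauSpreadFree.lean`).  So the DYNAMICS stub may deliver `DynamicCoreClauses` only (glue `PolyakovLift.dressedRitz_of_liftPartsCore`).
[cite: Luscher1983, §3] [cite: LuscherWolff1990] -/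
def DynamicCoreClauses (k : ℕ) (C : ℝ) {L : ℕ} [NeZero L] (β : ℝ) (u : Fin k → (GaugeConfig 3 L SU2 → ℝ)) : Prop :=
  (∀ i : Fin k,
    l2 (u i) (transferApply β (u i)) * levelValue su2Rep 1 (oneSiteCoupling β L) 0 ≤
        Real.exp (C * luscherLambda β L ^ 2 / L) *
          (levelValue su2Rep 1 (oneSiteCoupling β L) ((i : ℕ) + 1) * levelValue su2Rep L β 0) * l2 (u i) (u i) ∧
    levelValue su2Rep 1 (oneSiteCoupling β L) ((i : ℕ) + 1) * levelValue su2Rep L β 0 * l2 (u i) (u i) ≤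
        Real.exp (C * luscherLambda β L ^ 2 / L) *
          (l2 (u i) (transferApply β (u i)) * levelValue su2Rep 1 (oneSiteCoupling β L) 0)) ∧
  (∀ i l : Fin k, i ≠ l →
    |l2 (u i) (transferApply β (u l)) -
        (l2 (u i) (transferApply β (u i)) / l2 (u i) (u i) + l2 (u l) (transferApply β (u l)) / l2 (u l) (u l)) / 2 *
          l2 (u i) (u l)|
      ≤ C * (luscherLambda β L ^ 2 / L) * levelValue su2Rep L β 0 *
          (Real.sqrt (l2 (u i) (u i)) * Real.sqrt (l2 (u l) (u l))))

/-- `DynamicClauses ⇒ DynamicCoreClauses` (drop (o1), (o7)). [folklore] -/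
theorem dynamicCoreClauses_of_dynamicClauses {k : ℕ} {C : ℝ} {L : ℕ} [NeZero L] {β : ℝ}
    {u : Fin k → (GaugeConfig 3 L SU2 → ℝ)} (h : DynamicClauses k C β u) : DynamicCoreClauses k C β u :=
  ⟨h.2.1, h.2.2.1⟩

end Summit.QuantumFields.YangMills.Theorems.FemtoTransferGap.PolyakovLift

end
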